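import Summits.QuantumFields.BalabanUV.Beta.CombLevelZeroT2Law
import Summits.QuantumFields.BalabanUV.Beta.CombSecondOrderRemainderAn1Scaled

/-!
# `BalabanUV.Beta.CombLevelZeroT2LawScaled` — binder row D1, the (III″) κ-TWIN CHAIN (an2 W-3 l.63100 programme P5, brick P5-0b-κ): **THE LEVEL-0
# SECOND-ORDER REMAINDER OF THE κ-LITERAL VANISHES IDENTICALLY** — `combR2An1W Lc N cΛ w γ X2s 0 = 0` for EVERY group weight `w`

WHY (an2 RULING R-D1-g56-4 (4-2), W-3 l.63100 (S)∕(D5)∕(D6), W-5 + CORRECTION C-an2-g56-2 l.63171; leaf-01 g42 N-1 l.63157 `CENSUS-DEFCONE-g42.md` §3;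
leaf-03 g50 O-g50-1 l.63160 P1): the (III″) literal is ROOT M‴'s literal with its Λ GROUP carried at the group weight `w` (the programme's `κ`; `κ` is a
bound bond index in these terms): mixed table `w • symMixFFAt ρ_c Lc`, multiplier ∕ first-order Λ pin `w·cΛ`, mixed reflection remainder
`w • symRMrAn1 Lc cΛ γ`, base lock `cΛ·Lc⁴ = 2` kept verbatim.  Its second-order remainder is leaf-03 g50's slotted re-definition
`CombSecondOrderRemainderAn1Scaled.combR2An1W` (NOT `w •` the landed `combR2An1` — the slot objects carry degree-0, -1 and -2 parts in `w`).
THIS FILE is the κ-twin of the ONE brick of an2 gen 38's `CombLevelZeroT2Law` that the parity ∕ tadpole files (P5) consume: §5's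
`combR2An1_zero_eq_zero`.  LEVEL 0 IS SLOT-BLIND: `T2RecOf … mixFF 0 = cE₂ • wilsonW₂ + cB • vh₂S` whatever `mixFF` is (`SpineRooted.T2RecOf_zero_level`,
`rfl`), and the pure stencil `SpureRecOf … c 0` does not read its Λ pin; so the landed EXACT level-0 reflection law
`CombLevelZeroT2Law.T2RecOf_zero_bref_comb` — stated for EVERY pin — instantiated at the pin `w·cΛ` IS the law of the κ-literal's `T2_0`, and the
level-0 remainder (DEFINED as the reflection defect minus the contact word) is zero by the same two-line involution argument as the parent's
(`refK ∘ refK = id`, `(ε_κ ε_κ′)² = 1`).  [folklore] BY NAME; nothing of an2's ∕ an3's ∕ an1's ∕ leaf-03's restated.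
WHAT: `combR2An1W_zero_eq_zero` (every `N ≥ 2`, `cΛ`, `w`, `X2s`; `γ` with the displayed `hγ`; `Lc` odd).  At `w = 1` it is the parent's §5
(`CombSecondOrderRemainderAn1Scaled.combR2An1W_one`).
WHAT THIS IS NOT: no VALUE of `w` (the (III″) display `w = Lc¹²∕4` is the ROOT corollary's, `D1LiteralLagrangianRoot`); no lock used; no binder of the
row discharged (0∕4: hW, hR, D1Tel, D1Rep); ROOT M‴ p325680 and the root of record untouched; NOT D1, NEVER «G-an2-4 closed», NOT BetaPertH, NOT
continuum, NOT Clay.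

HONEST DEPENDENCY (page 1, mandatory): continuum YM on T⁴ ⇐ BetaPertH ∧ nine spine estimates (0/9 proved); BetaPertH ⇐ (D1) ∧ (D4) ∧ CAP+tail;
G-an2-4 gates asym, D1 and NE2/3/4.  DERIVED cell leaf ([folklore] BY NAME; β sub-cell, D1 formalisation swarm leaf prover 01
(`b2b-balaban-beta-d1-formalise-leaf-01` gen 42), 2026-08-25 (v1); INTENT I-leaf01-g42-1 «P5-κ» l.63217); over an2 gen 38's `CombLevelZeroT2Law` (the
law BY NAME) and leaf-03 g50's `CombSecondOrderRemainderAn1Scaled` (the slotted definition); no statement of Bałaban's papers, no `[cite:]`, no `Prop`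
fact, no `def`; no existing file touched.
-/

noncomputable section

open Finset
open scoped BigOperators
open Literature.MathematicalPhysics.QuantumFieldTheory
open Literature.MathematicalPhysics.QuantumFieldTheory.Balaban1983to89
open Literature.MathematicalPhysics.QuantumFieldTheory.Balaban1983to89.Beta
open ExpKernelCalculus (MKer comp)
open PolarizationSign (reflSign)
open KernelReflection (refK)
open ResolventReflection (bref Φ reflSign_mul_self)
open AveragingContoursRooted (ctr)
open OneStepResolventKernel (Fib)
open BalabanStepJetsSucc (wVH)
open Summit.QuantumFields.BalabanUV.Beta.SpineRooted (SpureRecOf M1Of T2RecOf T2RecOf_zero_level)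
open Summit.QuantumFields.BalabanUV.Beta.BorderedHessian (stepScale)
open Summit.QuantumFields.BalabanUV.Beta.CombLevelZeroT2Law (T2RecOf_zero_bref_comb)
open Summit.QuantumFields.BalabanUV.Beta.CombSecondOrderRemainderAn1Scaled (combR2An1W)
open Summit.QuantumFields.BalabanUV.Beta.E3LevelOneReflection (refK_smul refK_Φ_refK_Φ)

namespace Summit.QuantumFields.BalabanUV.Beta.CombLevelZeroT2LawScaled

variable {Lc : ℕ} [NeZero Lc]

/-- [folklore] **`combR2An1W … 0 = 0` — THE LEVEL-0 T2-REMAINDER OF THE κ-LITERAL VANISHES IDENTICALLY** (every `N ≥ 2`, base pin `cΛ`, group weight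
`w`, contact slot `X2s`; `γ` with the displayed `hγ`; `Lc` odd): leaf-03's `combR2An1W` at level `0` is DEFINED as the α-reflection defect of the
κ-literal's `T2_0` minus its contact word; level `0` is blind to the mixed-table slot (`T2RecOf_zero_level`) and to the Λ pin of the pure stencil,
so an2's EXACT level-0 law `CombLevelZeroT2Law.T2RecOf_zero_bref_comb` at the pin `w·cΛ` says that defect IS the contact word
(`refK ∘ refK = id`, `(ε_κ ε_κ′)² = 1`).  The κ-twin of `CombLevelZeroT2Law.combR2An1_zero_eq_zero`; at `w = 1` it is that lemma
(`CombSecondOrderRemainderAn1Scaled.combR2An1W_one`). -/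
theorem combR2An1W_zero_eq_zero (hLc : Odd Lc) {N : ℕ} (hN : 2 ≤ N) (cΛ w : ℝ) (γ : ℕ → ℝ)
    (hγ : ∀ j, γ j = -((Lc : ℝ) ^ 8 / 2) * wVH 3 Lc j / (stepScale 3 Lc j * (Lc : ℝ) ^ 4))
    (X2s : ℕ → Fin 4 → Fin 4 → (Fin 4 → ℤ) → Fin 4 → (Fin 4 → ℤ) → (Fin 4 → ℤ) → Fib 3 → ℝ)
    (α κ : Fin 4) (u : Fin 4 → ℤ) (κ' : Fin 4) (u' : Fin 4 → ℤ) :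
    combR2An1W Lc N cΛ w γ X2s 0 α κ u κ' u' = 0 := by
  have hT := T2RecOf_zero_bref_comb (Lc := Lc) hLc hN (w * cΛ) γ hγ α κ u κ' u'
  have he : (reflSign α κ * reflSign α κ') * (reflSign α κ * reflSign α κ') = 1 := by
    rw [show (reflSign α κ * reflSign α κ') * (reflSign α κ * reflSign α κ') = (reflSign α κ * reflSign α κ) * (reflSign α κ' * reflSign α κ') by ring,
      reflSign_mul_self, reflSign_mul_self, one_mul]
  simp only [combR2An1W, T2RecOf_zero_level] at hT ⊢
  rw [hT, refK_smul, refK_Φ_refK_Φ, smul_smul, he, one_smul]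
  abel

end Summit.QuantumFields.BalabanUV.Beta.CombLevelZeroT2LawScaled

end
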